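import Mathlib
import Literature.NumberTheory.Irrationality.Lai2025TwoAdic.GeneralRationalFunctionB
import HarnessLib

/-!
# Lai–Lupu–Sprang 2025, §3 and §5 (first half): the rational function
# `R_n(t) = p^{pn} n!^s t^{M₀} ∏_{j=1}^{p−1}(t + j/p)_n / (t)_{n+1}^{p−1+s}`, its partial fractions (Definition 3.2),
# `ρ_1 = 0` (Lemma 4.1) and `d_n^{p−1+s−i} r_{i,k} ∈ ℤ` (Lemma 5.3) — PROVED

Topic `Literature/NumberTheory/Irrationality/LaiLupuSprang2025`.  Source: L. Lai, C. Lupu, J. Sprang, *On the irrationality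
of certain `p`-adic zeta values*, Res. Math. Sci. 12 (2025), Paper No. 77 = arXiv:2505.23088 [LaiLupuSprang2025] (held text
`paper:arxiv-2505.23088`, chunks p0005 = §3 "Rational functions", p0006 = §4 "Linear forms", p0007 = §5 "Arithmetic
properties", read on the page).  PROOF FILE (definitions with bodies + theorems; no named fact, net debt 0).  First file of
the discharge of the tree's named fact `PAdicZetaValues.laiLupuSprang2025_theorem11` ([LaiLupuSprang2025, Thm 1.1]: «For any
prime number `p ≥ 5`, there exists an odd integer `i` in the interval `[3, c_p]` such that the `p`-adic zeta value `ζ_p(i)` is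
irrational»), following the printed proof on the pattern of the tree's Lai 2025 files (`Lai2025TwoAdic/GeneralRationalFunctionB`,
whose vocabulary `divDeriv`, `IsDInt`, `Greg`, `pfEval`, `powShifts`, `TaylorBound` is reused).

## Source, as printed ([LaiLupuSprang2025, §§3–5])

* §3: «From now on, we fix any prime `p ≥ 5`. … Fix a positive integer `s`.  Let `N₀ = v_p(p−1+s)` and `M₀ = p^{2+N₀}·s − 1`
  [(3.1)].  Note that `M₀ ≤ p²(p−1+s)s − 1 < (p+s)⁴` [(3.2)].
  **Definition 3.1.** We define for any positive integer `n > (p+s)⁴` the rational function `R_n(t) ∈ ℚ(t)` by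
  `R_n(t) := p^{pn} · n!^s · t^{M₀} · ∏_{j=1}^{p−1}(t + j/p)_n / (t)_{n+1}^{p−1+s}`.
  … By Definition 3.1 and Eq. (3.2), we have `deg R_n = M₀ − (p−1) − s(n+1) ≤ −2` for every `n > (p+s)⁴`.
  Note that `M₀ ≥ p²s − 1 > p−1+s`, so `t = 0` is not a pole of `R_n(t)`.
  **Definition 3.2.** For any integer `n > (p+s)⁴`, we denote the partial fraction decomposition of `R_n(t)` by
  `R_n(t) =: Σ_{i=1}^{p−1+s} Σ_{k=1}^{n} r_{i,k}/(t+k)^i` [(def:r_ik)], where the coefficients `r_{i,k} ∈ ℚ` are uniquely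
  determined by `R_n(t)`.»
* §4: «**Lemma 4.1.** Define `ρ_1 := Σ_{k=1}^{n} r_{1,k}`.  Then we have `ρ_1 = 0`.  *Proof.* By (def:r_ik) and
  `deg R_n ≤ −2`, we have `ρ_1 = lim_{t→∞} tR_n(t) = 0`.»  «`ρ_i := Σ_{k=1}^{n} r_{i,k}` (`2 ≤ i ≤ p−1+s`) [(4.3)] … and
  `ρ_{0,j/p} := −Σ_{i=1}^{p−1+s} Σ_{k=1}^{n} Σ_{ν=0}^{k−1} r_{i,k}/(ν + j/p)^i` [(4.4)] … `ρ_0 := Σ_{j=1}^{p−1} ρ_{0,j/p}` [(4.8)].»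
* §5: «**Lemma 5.1** ([Zud2004]). Let `G(t) = n!/(t)_{n+1}`.  Then `d_n^λ 𝒟_λ(G(t)(t+k))|_{t=−k} ∈ ℤ` …
  **Lemma 5.2** ([Lai2025+]). … `F(t) = b^n (∏_{q∣b} q^{⌊n/(q−1)⌋}) · (t + a/b)_n/n!`.  Then, for any integer `k ∈ ℤ` and
  any integer `λ ≥ 0`, we have `d_n^λ 𝒟_λ(F(t))|_{t=−k} ∈ ℤ`.
  **Lemma 5.3.** For any `i ∈ {1,2,…,p−1+s}` and any `k ∈ {1,2,…,n}`, we have `d_n^{p−1+s−i} r_{i,k} ∈ ℤ`.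
  *Proof.* By (def:r_ik), we have `r_{i,k} = 𝒟_{p−1+s−i}(R_n(t)(t+k)^{p−1+s})|_{t=−k}`.  Let `G(t) = n!/(t)_{n+1}`,
  `F_{j/p}(t) = p^n · p^{⌊n/(p−1)⌋} · (t + j/p)_n/n!` for any `j ∈ {1,…,p−1}`, `F_∞(t) = t^{M₀}`,
  `A = p^{n − (p−1)⌊n/(p−1)⌋} ∈ ℕ`.  It is straightforward to check that the following identity holds:
  `R_n(t) = A · F_∞(t) · G(t)^{p−1+s} · ∏_{j=1}^{p−1} F_{j/p}(t)` [(5.1)].  Therefore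
  `r_{i,k} = 𝒟_{p−1+s−i}(A · F_∞(t) · (G(t)(t+k))^{p−1+s} · ∏_{j=1}^{p−1} F_{j/p}(t))|_{t=−k}`.  Applying the Leibniz rule …
  By Lemma 5.1 and Lemma 5.2, the value at `t = −k` of each factor in the product is an integer. … Therefore, we have
  `d_n^{p−1+s−i} r_{i,k} ∈ ℤ` as desired.»

## What is formalised (all PROVED; `p` is a parameter, prime where needed)

* `N0 p s = v_p(p−1+s)`, `M0 p s = p^{2+N₀} s − 1` ((3.1); `M0_lt`: `M₀ < (p+s)⁴`, `pole_order_le_M0`: `p−1+s ≤ M₀`); **Definition 3.1** `Rn p s n` (as a function `ℚ → ℚ`, the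
  poles being `0, −1, …, −n` before cancellation of `t = 0` by `t^{M₀}`);
* the bricks of (5.1): `pBrick p j n` = `F_{j/p}` (**Lemma 5.2** `pBrick_isDInt`: an integer-valued polynomial of degree
  `n`, by the tree's `LaiYu2020.factorial_dvd_primeFactors_pow_mul_prod_progression`), `Acst p n = A`, the tree's
  `Greg n k = G(t)(t+k)` (**Lemma 5.1** = tree `RivoalZudilin2020.Greg_isDInt`), and the BRICK FORM
  `RnReg p s n k = A · t^{M₀} · Greg^{p−1+s} · ∏_j F_{j/p}` of `R_n(t)(t+k)^{p−1+s}` (**(5.1)** `RnReg_eq`), `RnReg_isDInt`;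
* **Definition 3.2**: `coeffR p s n i k := 𝒟_{p−1+s−i}(RnReg)(−k) = r_{i,k}`; the expansion (def:r_ik) off the poles
  (`exists_Rn_eq_pfEval`, `coeffR_eq_of_pfEval` — «uniquely determined» —, `Rn_eq_sum_coeffR`; here the sum runs over
  `0 ≤ k ≤ n`, the coefficients at the non-pole `k = 0` being those of any expansion, hence harmless); `coeffR_top_eq`;
* **Lemma 5.3** `exists_int_lcm_pow_mul_coeffR` (`d_n^{p−1+s−i} r_{i,k} ∈ ℤ`, all `i`, `k ≤ n`);
* `rho p s n i = ρ_i` ((4.3), and `ρ_1`), `rhoZeroJ p s n j = ρ_{0,j/p}` ((4.4)), `rhoZero p s n = ρ_0` ((4.8));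
  `exists_int_lcm_pow_mul_rho` (the `d_n`-part of Lemma 5.5);
* **Lemma 4.1** `rho_one_eq_zero`: `ρ_1 = 0` under the degree hypothesis `M₀ + (p−1)n + 2 ≤ (p−1+s)(n+1)` (which is the
  printed `deg R_n ≤ −2`, implied by `n > (p+s)⁴`: `degree_condition_of_lt`).

Cell zeta5-irr / pub-zeta5 (HONEST FRAMING: systematic search; no irrationality claim unless kernel-certified): auxiliary
`p`-adic material for a RECORD entry (`ζ_p(i)`, `p ≥ 5`); nothing here bears on `ζ(5) ∈ ℝ`.
-/

noncomputable section

open Finset Filter Polynomial Literature.Analysis.Calculus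
open Literature.NumberTheory.Transcendental
open Literature.NumberTheory.Irrationality.RivoalZudilin2020 (Greg Greg_eq Greg_isDInt)
open Literature.NumberTheory.Irrationality.LaiSprangZudilin2026 (divDeriv_eq_coeff_of_pfEval)
open Literature.NumberTheory.Irrationality.LaiSprangZudilin2026.Lemma53 (Greg_neg)
open Literature.NumberTheory.Irrationality.Lai2025TwoAdic (powShifts contDiffAt_Greg Greg_eq_mul_prod_inv TaylorBound)
open scoped Nat Topology

namespace Literature.NumberTheory.Irrationality.LaiLupuSprang2025

/-! ## §1. The parameters `N₀, M₀` and Definition 3.1 -/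

/-- `N₀ = v_p(p − 1 + s)`. [cite: LaiLupuSprang2025, §3 (3.1)] -/
def N0 (p s : ℕ) : ℕ := padicValNat p (p - 1 + s)

/-- `M₀ = p^{2+N₀} · s − 1`. [cite: LaiLupuSprang2025, §3 (3.1)] -/
def M0 (p s : ℕ) : ℕ := p ^ (2 + N0 p s) * s - 1

/-- **Definition 3.1**: `R_n(t) := p^{pn} · n!^s · t^{M₀} · ∏_{j=1}^{p−1} (t + j/p)_n / (t)_{n+1}^{p−1+s}`, with
`(t + j/p)_n = ∏_{m<n}(t + j/p + m)` and `(t)_{n+1} = ∏_{m ≤ n}(t + m)`. [cite: LaiLupuSprang2025, Definition 3.1] -/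
def Rn (p s n : ℕ) (t : ℚ) : ℚ :=
  (p : ℚ) ^ (p * n) * (n ! : ℚ) ^ s * t ^ M0 p s *
    (∏ j ∈ Ico 1 p, ∏ m ∈ range n, (t + ((j : ℚ) / p + m))) / (∏ m ∈ range (n + 1), (t + m)) ^ (p - 1 + s)

/-- `p^{N₀} ≤ p − 1 + s` for `s ≥ 1` (`p^{v_p(p−1+s)} ∣ p−1+s`). [cite: LaiLupuSprang2025, §3 (3.2)] -/
theorem pow_N0_le {p s : ℕ} (hs : 1 ≤ s) : p ^ N0 p s ≤ p - 1 + s :=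
  Nat.le_of_dvd (by omega) pow_padicValNat_dvd

/-- **(3.2)**: `M₀ ≤ p²(p−1+s)s − 1 < (p+s)⁴` (`s ≥ 1`). [cite: LaiLupuSprang2025, §3 (3.2)] -/
theorem M0_lt {p s : ℕ} (hs : 1 ≤ s) : M0 p s < (p + s) ^ 4 := by
  unfold M0
  have h1 : p ^ (2 + N0 p s) * s ≤ p ^ 2 * (p - 1 + s) * s := by
    rw [pow_add, mul_assoc, mul_assoc]
    exact Nat.mul_le_mul_left _ (Nat.mul_le_mul_right _ (pow_N0_le hs))
  have h2 : p ^ 2 * (p - 1 + s) * s < (p + s) ^ 4 := by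
    have h3 : p - 1 + s ≤ p + s := by omega
    have h4 : p ^ 2 * (p - 1 + s) * s ≤ p ^ 2 * (p + s) * s := by gcongr
    have key : p ^ 2 * s + 1 ≤ (p + s) ^ 3 := by
      have : 1 ≤ s ^ 3 := Nat.one_le_pow _ _ hs
      nlinarith [Nat.zero_le (p * s), Nat.zero_le p, Nat.zero_le s, Nat.zero_le (p * p * s), Nat.zero_le (p * s * s)]
    have h5 : p ^ 2 * (p + s) * s < (p + s) ^ 4 :=
      calc p ^ 2 * (p + s) * s = (p + s) * (p ^ 2 * s) := by ring
        _ < (p + s) * (p ^ 2 * s + 1) := by nlinarith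
        _ ≤ (p + s) * (p + s) ^ 3 := Nat.mul_le_mul_left _ key
        _ = (p + s) ^ 4 := by ring
    exact h4.trans_lt h5
  omega

/-- `p − 1 + s ≤ M₀` for `p ≥ 2`, `s ≥ 1` («`M₀ ≥ p²s − 1 > p − 1 + s`, so `t = 0` is not a pole of `R_n(t)`»).
[cite: LaiLupuSprang2025, §3 (after Definition 3.2)] -/
theorem pole_order_le_M0 {p s : ℕ} (hp : 2 ≤ p) (hs : 1 ≤ s) : p - 1 + s ≤ M0 p s := by
  unfold M0
  have h1 : p ^ 2 * s ≤ p ^ (2 + N0 p s) * s :=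
    Nat.mul_le_mul_right _ (Nat.pow_le_pow_right (by omega) (by omega))
  have h3 : p + 1 ≤ p ^ 2 := by nlinarith
  have h4 : p ≤ p * s := Nat.le_mul_of_pos_right p hs
  have h2 : p + s ≤ p ^ 2 * s :=
    calc p + s ≤ p * s + s := by omega
      _ = (p + 1) * s := by ring
      _ ≤ p ^ 2 * s := Nat.mul_le_mul_right s h3
  omega

/-- The degree condition `deg R_n ≤ −2`, i.e. `M₀ + (p−1)n + 2 ≤ (p−1+s)(n+1)`, holds for `n > (p+s)⁴` (`s ≥ 1`).
[cite: LaiLupuSprang2025, §3 ("deg R_n = M₀ − (p−1) − s(n+1) ≤ −2 for every n > (p+s)⁴")] -/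
theorem degree_condition_of_lt {p s n : ℕ} (hs : 1 ≤ s) (hn : (p + s) ^ 4 < n) :
    M0 p s + (p - 1) * n + 2 ≤ (p - 1 + s) * (n + 1) := by
  have h := M0_lt (p := p) hs
  have : M0 p s + 2 ≤ s * (n + 1) := by nlinarith
  nlinarith

/-! ## §2. The bricks of (5.1) and the brick form of `R_n(t)(t+k)^{p−1+s}` -/

/-- **The brick `F_{j/p}(t) = p^n · p^{⌊n/(p−1)⌋} · (t + j/p)_n / n!`** of (5.1) (Lemma 5.2 with `a/b = j/p`).
[cite: LaiLupuSprang2025, Lemma 5.3 (proof: definition of F_{j/p})] -/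
def pBrick (p j n : ℕ) (t : ℚ) : ℚ :=
  (p : ℚ) ^ n * (p : ℚ) ^ (n / (p - 1)) / (n ! : ℚ) * ∏ m ∈ range n, (t + ((j : ℚ) / p + m))

/-- **The constant `A = p^{n − (p−1)⌊n/(p−1)⌋} ∈ ℕ`** of (5.1). [cite: LaiLupuSprang2025, Lemma 5.3 (proof: definition of A)] -/
def Acst (p n : ℕ) : ℕ := p ^ (n - (p - 1) * (n / (p - 1)))

/-- **The brick form (5.1) of `R_n(t)(t+k)^{p−1+s}`**, regular at `t = −k`:
`A · t^{M₀} · (G(t)(t+k))^{p−1+s} · ∏_{j=1}^{p−1} F_{j/p}(t)` with the tree's `Greg n k = G(t)(t+k) = n!(t+k)/(t)_{n+1}`.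
[cite: LaiLupuSprang2025, Lemma 5.3 (proof, (5.1))] -/
def RnReg (p s n k : ℕ) (t : ℚ) : ℚ :=
  (Acst p n : ℚ) * t ^ M0 p s * Greg n k t ^ (p - 1 + s) * ∏ j ∈ Ico 1 p, pBrick p j n t

/-- The prime-power bookkeeping of (5.1): `p^{pn} = A · (p^n p^{⌊n/(p−1)⌋})^{p−1}` (`p ≥ 1`).
[cite: LaiLupuSprang2025, Lemma 5.3 (proof, (5.1))] -/
theorem pow_mul_eq_Acst_mul {p : ℕ} (hp : 1 ≤ p) (n : ℕ) :
    (p : ℚ) ^ (p * n) = (Acst p n : ℚ) * ((p : ℚ) ^ n * (p : ℚ) ^ (n / (p - 1))) ^ (p - 1) := by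
  unfold Acst
  push_cast
  rw [← pow_add, ← pow_mul, ← pow_add]
  congr 1
  obtain ⟨d, rfl⟩ : ∃ d, p = d + 1 := ⟨p - 1, by omega⟩
  simp only [Nat.add_sub_cancel]
  set q := n / d with hq_def
  have h : d * q ≤ n := by rw [mul_comm]; exact Nat.div_mul_le_self n d
  obtain ⟨r, hr⟩ := Nat.exists_eq_add_of_le h
  rw [hr, Nat.add_sub_cancel_left]
  ring

/-- **(5.1)**: off the poles `0, −1, …, −n` and off `−k`, `RnReg p s n k t = R_n(t) · (t+k)^{p−1+s}` (`p ≥ 1`).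
[cite: LaiLupuSprang2025, Lemma 5.3 (proof, (5.1))] -/
theorem RnReg_eq {p : ℕ} (hp : 1 ≤ p) (s n k : ℕ) {t : ℚ} (ht : ∀ j ∈ range (n + 1), t + j ≠ 0) (htk : t + k ≠ 0) :
    RnReg p s n k t = Rn p s n t * (t + k) ^ (p - 1 + s) := by
  have hprod : ∏ j ∈ range (n + 1), (t + j) ≠ 0 := prod_ne_zero_iff.2 ht
  have hfac : (n ! : ℚ) ≠ 0 := by exact_mod_cast Nat.factorial_ne_zero n
  have hbr : ∏ j ∈ Ico 1 p, pBrick p j n t =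
      ((p : ℚ) ^ n * (p : ℚ) ^ (n / (p - 1)) / (n ! : ℚ)) ^ (p - 1) *
        ∏ j ∈ Ico 1 p, ∏ m ∈ range n, (t + ((j : ℚ) / p + m)) := by
    unfold pBrick
    rw [prod_mul_distrib, prod_const, Nat.card_Ico]
  rw [RnReg, hbr, Greg_eq_mul_prod_inv n k htk, prod_inv_distrib, Rn, pow_mul_eq_Acst_mul hp n, pow_add, pow_add]
  rw [mul_pow, mul_pow, mul_pow, mul_pow, div_pow, inv_pow, inv_pow]
  field_simp
  ring

/-- `pBrick p j n` (a polynomial) is smooth everywhere. [folklore] -/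
private theorem contDiffAt_pBrick (p j n : ℕ) (x : ℚ) {N : WithTop ℕ∞} : ContDiffAt ℚ N (pBrick p j n) x := by
  unfold pBrick
  fun_prop

/-- `RnReg p s n k` is smooth at every `x` off the poles other than `−k`. [cite: LaiLupuSprang2025, Lemma 5.3 (proof)] -/
theorem contDiffAt_RnReg (p s n k : ℕ) {x : ℚ} (hx : ∀ l ∈ range (n + 1), l ≠ k → x + l ≠ 0)
    {N : WithTop ℕ∞} : ContDiffAt ℚ N (RnReg p s n k) x := by
  unfold RnReg
  have hG := contDiffAt_Greg n k hx (N := N)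
  exact ((contDiffAt_const.mul (contDiffAt_id.pow _)).mul (hG.pow _)).mul
    (contDiffAt_prod fun j _ => contDiffAt_pBrick p j n x)

/-- `−k` is off the other poles. [folklore] -/
private theorem neg_add_ne_zero_of_ne {k l : ℕ} (h : l ≠ k) : (-(k : ℚ)) + l ≠ 0 := by
  rw [show (-(k : ℚ) + l) = ((l : ℤ) - (k : ℤ) : ℤ) by push_cast; ring]
  exact_mod_cast sub_ne_zero.2 (by exact_mod_cast h : (l : ℤ) ≠ k)

/-- `RnReg p s n k` is smooth at `−k`. [cite: LaiLupuSprang2025, Lemma 5.3 (proof)] -/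
theorem contDiffAt_RnReg_neg (p s n k : ℕ) {N : WithTop ℕ∞} : ContDiffAt ℚ N (RnReg p s n k) (-(k : ℚ)) :=
  contDiffAt_RnReg p s n k fun _ _ hl => neg_add_ne_zero_of_ne hl

/-! ### Lemma 5.2: `F_{j/p}` is an integer-valued polynomial of degree `n` -/

/-- `F_{j/p}` as a polynomial. [cite: LaiLupuSprang2025, Lemma 5.2] -/
def pBrickPoly (p j n : ℕ) : ℚ[X] :=
  C ((p : ℚ) ^ n * (p : ℚ) ^ (n / (p - 1)) / (n ! : ℚ)) * ∏ m ∈ range n, (X + C ((j : ℚ) / p + m))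

/-- `pBrickPoly` evaluates to `pBrick`. [cite: LaiLupuSprang2025, Lemma 5.2] -/
theorem eval_pBrickPoly (p j n : ℕ) (t : ℚ) : (pBrickPoly p j n).eval t = pBrick p j n t := by
  rw [pBrickPoly, pBrick, eval_mul, eval_C, eval_prod]
  congr 1
  exact prod_congr rfl fun m _ => by rw [eval_add, eval_X, eval_C]

/-- `deg pBrickPoly ≤ n`. [cite: LaiLupuSprang2025, Lemma 5.2] -/
theorem natDegree_pBrickPoly_le (p j n : ℕ) : (pBrickPoly p j n).natDegree ≤ n := by
  unfold pBrickPoly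
  refine (natDegree_C_mul_le _ _).trans ((natDegree_prod_le _ _).trans ?_)
  refine (sum_le_sum (g := fun _ => 1) fun m _ => (natDegree_X_add_C _).le).trans ?_
  simp

/-- The value of `F_{j/p}` at an integer `k`: `n! · F_{j/p}(k) = p^{⌊n/(p−1)⌋} ∏_{m<n} (pk + j + mp)` (`p ≠ 0`).
[cite: LaiLupuSprang2025, Lemma 5.2 (proof: b^n (t + a/b)_n = ∏ (bt + a + mb))] -/
theorem factorial_mul_pBrick_intCast {p : ℕ} (hp : p ≠ 0) (j n : ℕ) (k : ℤ) :
    (n ! : ℚ) * pBrick p j n k = (((p : ℤ) ^ (n / (p - 1)) * ∏ m ∈ range n, ((p : ℤ) * k + j + m * p) : ℤ) : ℚ) := by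
  have hp' : (p : ℚ) ≠ 0 := by exact_mod_cast hp
  have hfac : (n ! : ℚ) ≠ 0 := by exact_mod_cast Nat.factorial_ne_zero n
  push_cast
  rw [pBrick]
  calc (n ! : ℚ) * ((p : ℚ) ^ n * (p : ℚ) ^ (n / (p - 1)) / (n ! : ℚ) * ∏ m ∈ range n, ((k : ℚ) + ((j : ℚ) / p + m)))
      = (p : ℚ) ^ (n / (p - 1)) * ((∏ _m ∈ range n, (p : ℚ)) * ∏ m ∈ range n, ((k : ℚ) + ((j : ℚ) / p + m))) := by
        rw [prod_const, card_range]; field_simp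
    _ = (p : ℚ) ^ (n / (p - 1)) * ∏ m ∈ range n, ((p : ℚ) * k + j + (m : ℚ) * p) := by
        rw [← prod_mul_distrib]
        congr 1
        refine prod_congr rfl fun m _ => ?_
        rw [mul_add, mul_add, mul_div_cancel₀ _ hp']
        ring

/-- `F_{j/p}(k) ∈ ℤ` for every integer `k` (`p` prime): `n! ∣ p^{⌊n/(p−1)⌋} ∏_{m<n}(pk + j + mp)` — the tree's
`LaiYu2020.factorial_dvd_primeFactors_pow_mul_prod_progression` with `b = p`. [cite: LaiLupuSprang2025, Lemma 5.2] -/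
theorem pBrick_intCast_isInt {p : ℕ} (hp : p.Prime) (j n : ℕ) (k : ℤ) : ∃ z : ℤ, pBrick p j n k = z := by
  have hfac : (n ! : ℚ) ≠ 0 := by exact_mod_cast Nat.factorial_ne_zero n
  have h := LaiYu2020.factorial_dvd_primeFactors_pow_mul_prod_progression p hp.pos ((p : ℤ) * k + j) n
  rw [Nat.Prime.primeFactors hp, prod_singleton] at h
  obtain ⟨z, hz⟩ := h
  refine ⟨z, ?_⟩
  have h1 := factorial_mul_pBrick_intCast hp.ne_zero j n k
  rw [hz] at h1
  push_cast at h1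
  exact mul_left_cancel₀ hfac h1

/-- **Lemma 5.2** (`b = p` prime): `d_n^λ · 𝒟_λ(F_{j/p})(k) ∈ ℤ` for every integer `k` and every `λ` — `F_{j/p}` is an
integer-valued polynomial of degree `n` (tree `isDInt_eval_of_intValued`). [cite: LaiLupuSprang2025, Lemma 5.2] -/
theorem pBrick_isDInt {p : ℕ} (hp : p.Prime) (j n : ℕ) (k : ℤ) (N : ℕ) :
    IsDInt (Nat.lcmUpto n) N (pBrick p j n) k := by
  have h := RivoalZudilin2020.isDInt_eval_of_intValued (pBrickPoly p j n) (natDegree_pBrickPoly_le p j n)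
    (fun i _ => by rw [eval_pBrickPoly]; exact_mod_cast pBrick_intCast_isInt hp j n i) k N
  refine h.congr (Eventually.of_forall fun t => ?_)
  exact eval_pBrickPoly p j n t

/-- **The brick form is `IsDInt (d_n)` at `−k`** (`k ≤ n`, `p` prime): Leibniz (tree `IsDInt.mul/pow/prod`) over the
integer constant `A`, the integer polynomial `t^{M₀}`, the `p−1+s` bricks `G(t)(t+k)` (**Lemma 5.1** = tree
`RivoalZudilin2020.Greg_isDInt`) and the `p−1` bricks `F_{j/p}` (**Lemma 5.2**). [cite: LaiLupuSprang2025, Lemma 5.3 (proof)] -/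
theorem RnReg_isDInt {p : ℕ} (hp : p.Prime) (s n : ℕ) {k : ℕ} (hk : k ≤ n) (N : ℕ) :
    IsDInt (Nat.lcmUpto n) N (RnReg p s n k) (-(k : ℚ)) := by
  have hA : IsDInt (Nat.lcmUpto n) N (fun _ : ℚ => (Acst p n : ℚ)) (-(k : ℚ)) := by
    have h := IsDInt.const (Nat.lcmUpto n) N (Acst p n : ℤ) (-(k : ℚ))
    push_cast at h
    exact h
  have hT : IsDInt (Nat.lcmUpto n) N (fun t : ℚ => t ^ M0 p s) (-(k : ℚ)) := by
    have h := IsDInt.linear (Nat.lcmUpto n) N 1 0 (-(k : ℤ))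
    push_cast at h
    exact (h.congr (Eventually.of_forall fun t => by ring)).pow _
  have hG := (Greg_isDInt n hk N).pow (p - 1 + s)
  have hF : IsDInt (Nat.lcmUpto n) N (fun t => ∏ j ∈ Ico 1 p, pBrick p j n t) (-(k : ℚ)) :=
    IsDInt.prod (Ico 1 p) fun j _ => by simpa using pBrick_isDInt hp j n (-(k : ℤ)) N
  exact ((hA.mul hT).mul hG).mul hF

/-! ## §3. Definition 3.2: the coefficients `r_{i,k}` and Lemma 5.3 -/

/-- The coefficient `r_{i,k}` of (def:r_ik), DEFINED as the Taylor coefficient `𝒟_{p−1+s−i}(R_n(t)(t+k)^{p−1+s})|_{t=−k}`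
of the brick form («`r_{i,k} = 𝒟_{p−1+s−i}(R_n(t)(t+k)^{p−1+s})|_{t=−k}`»).
[cite: LaiLupuSprang2025, Definition 3.2 (def:r_ik) and Lemma 5.3 (proof, first display)] -/
def coeffR (p s n i k : ℕ) : ℚ := divDeriv (p - 1 + s - i) (RnReg p s n k) (-(k : ℚ))

/-- **Lemma 5.3:** `d_n^{p−1+s−i} · r_{i,k} ∈ ℤ` (`k ≤ n`; here for every `i`).
[cite: LaiLupuSprang2025, Lemma 5.3] -/
theorem exists_int_lcm_pow_mul_coeffR {p : ℕ} (hp : p.Prime) (s n : ℕ) {k : ℕ} (hk : k ≤ n) (i : ℕ) :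
    ∃ z : ℤ, (Nat.lcmUpto n : ℚ) ^ (p - 1 + s - i) * coeffR p s n i k = z :=
  (RnReg_isDInt hp s n hk (p - 1 + s - i)).isInt (p - 1 + s - i) le_rfl

/-- `r_{p−1+s,k}` is the value of the brick form at `−k`. [cite: LaiLupuSprang2025, Lemma 5.4 (proof, case i = 0:
"r_{p−1+s,k} = R_n(t)(t+k)^{p−1+s}|_{t=−k}")] -/
theorem coeffR_top_eq (p s n k : ℕ) : coeffR p s n (p - 1 + s) k = RnReg p s n k (-(k : ℚ)) := by
  rw [coeffR, Nat.sub_self, divDeriv_zero]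

/-! ### Existence of the expansion (def:r_ik) and identification of its coefficients -/

/-- `|powShifts n c| = c(n+1)` (re-proved: the tree's copy is private). [folklore] -/
private theorem length_powShifts (n c : ℕ) : (powShifts n c).length = c * (n + 1) := by
  induction c with
  | zero => simp [powShifts]
  | succ c ih =>
    simp only [powShifts, List.length_append, Finset.length_toList, card_range, ih]
    ring

/-- Every shift is `≤ n`. [folklore] -/
private theorem mem_range_of_mem_powShifts {n c i : ℕ} (hi : i ∈ powShifts n c) : i ∈ range (n + 1) := by
  induction c with
  | zero => simp [powShifts] at hi
  | succ c ih =>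
    simp only [powShifts, List.mem_append, Finset.mem_toList] at hi
    exact hi.elim id ih

/-- Every shift occurs at most `c` times. [folklore] -/
private theorem count_powShifts_le (n c i : ℕ) : (powShifts n c).count i ≤ c := by
  induction c with
  | zero => simp [powShifts]
  | succ c ih =>
    have h1 : (range (n + 1)).toList.count i ≤ 1 :=
      List.nodup_iff_count_le_one.1 (Finset.nodup_toList _) i
    simp only [powShifts, List.count_append]
    omega

/-- `∏_{i ∈ powShifts n c} (t+i)⁻¹ = (∏_{j ≤ n} (t+j))^{−c}`. [folklore] -/
private theorem prod_powShifts (n c : ℕ) (t : ℚ) :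
    ((powShifts n c).map fun i : ℕ => (t + (i : ℚ))⁻¹).prod = ((∏ j ∈ range (n + 1), (t + j)) ^ c)⁻¹ := by
  induction c with
  | zero => simp [powShifts]
  | succ c ih =>
    have h1 : (((range (n + 1)).toList).map fun i : ℕ => (t + (i : ℚ))⁻¹).prod
        = (∏ j ∈ range (n + 1), (t + j))⁻¹ := by
      rw [Finset.prod_map_toList, prod_inv_distrib]
    simp only [powShifts, List.map_append, List.prod_append, h1, ih, pow_succ]
    rw [mul_inv, mul_comm]

/-- A bound on the degree of `∏_{m<n}(X + u_m)`. [folklore] -/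
private theorem natDegree_prod_X_add_C_le (n : ℕ) (u : ℕ → ℚ) :
    (∏ m ∈ range n, (X + C (u m) : ℚ[X])).natDegree ≤ n := by
  refine (natDegree_prod_le _ _).trans ?_
  refine (sum_le_sum (g := fun _ => 1) fun m _ => (natDegree_X_add_C _).le).trans ?_
  simp

/-- EXISTENCE of an expansion of `R_n` with poles of order `≤ p−1+s` at `0, −1, …, −n` and no polynomial part, under the
degree condition `M₀ + (p−1)n < (p−1+s)(n+1)` («`deg R_n ≤ −2`»; tree `exists_pfEval_eq_eval_mul_prod_inv`).
[cite: LaiLupuSprang2025, Definition 3.2 (def:r_ik)] -/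
theorem exists_Rn_eq_pfEval (p s n : ℕ) (hdeg : M0 p s + (p - 1) * n < (p - 1 + s) * (n + 1)) :
    ∃ c : ℕ → ℕ → ℚ, ∀ t : ℚ,
      (∀ i ∈ range (n + 1), t + i ≠ 0) → Rn p s n t = pfEval (range (n + 1)) (fun _ => p - 1 + s) c t := by
  classical
  set P : ℚ[X] := C ((p : ℚ) ^ (p * n) * (n ! : ℚ) ^ s) * X ^ M0 p s *
    ∏ j ∈ Ico 1 p, ∏ m ∈ range n, (X + C ((j : ℚ) / p + m)) with hP
  have hprod : (∏ j ∈ Ico 1 p, ∏ m ∈ range n, (X + C ((j : ℚ) / p + m) : ℚ[X])).natDegree ≤ (p - 1) * n := by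
    refine (natDegree_prod_le _ _).trans ?_
    refine (sum_le_sum fun j _ => natDegree_prod_X_add_C_le n fun m => ((j : ℕ) : ℚ) / p + m).trans ?_
    rw [sum_const, Nat.card_Ico, smul_eq_mul]
  have hdegP : P.natDegree ≤ M0 p s + (p - 1) * n := by
    rw [hP]
    have h1 : (C ((p : ℚ) ^ (p * n) * (n ! : ℚ) ^ s) * X ^ M0 p s).natDegree ≤ M0 p s :=
      (natDegree_C_mul_le _ _).trans (natDegree_X_pow _).le
    exact natDegree_mul_le.trans (add_le_add h1 hprod)
  have hdeg' : P.natDegree < (powShifts n (p - 1 + s)).length := by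
    rw [length_powShifts]; omega
  obtain ⟨c, hc⟩ := exists_pfEval_eq_eval_mul_prod_inv (range (n + 1)) P (powShifts n (p - 1 + s))
    (fun i hi => mem_range_of_mem_powShifts hi) hdeg'
  have hPeval : ∀ t : ℚ, P.eval t = (p : ℚ) ^ (p * n) * (n ! : ℚ) ^ s * t ^ M0 p s *
      ∏ j ∈ Ico 1 p, ∏ m ∈ range n, (t + ((j : ℚ) / p + m)) := by
    intro t
    rw [hP]
    simp only [eval_mul, eval_C, eval_pow, eval_X, eval_prod, eval_add]
  have hR : ∀ t : ℚ, Rn p s n t = P.eval t * ((powShifts n (p - 1 + s)).map fun i : ℕ => (t + (i : ℚ))⁻¹).prod := by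
    intro t
    rw [prod_powShifts, hPeval, Rn, div_eq_mul_inv]
  have hPF : IsPF (range (n + 1)) (fun i => (powShifts n (p - 1 + s)).count i) (Rn p s n) :=
    ⟨c, fun t ht => (hR t).trans (hc t ht)⟩
  obtain ⟨c', hc'⟩ := hPF.mono fun i _ => count_powShifts_le n (p - 1 + s) i
  exact ⟨c', hc'⟩

/-- For ANY expansion `R_n = Σ_{k ≤ n} Σ_{r ≤ p−1+s} c_{k,r}(t+k)^{−r}` off the poles, `c_{k,i} = r_{i,k}`
(`k ≤ n`, `1 ≤ i ≤ p−1+s`; `p ≥ 1`): «the coefficients `r_{i,k} ∈ ℚ` are uniquely determined by `R_n(t)`».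
[cite: LaiLupuSprang2025, Definition 3.2] -/
theorem coeffR_eq_of_pfEval {p : ℕ} (hp : 1 ≤ p) (s n : ℕ) {c : ℕ → ℕ → ℚ}
    (hc : ∀ t : ℚ, (∀ i ∈ range (n + 1), t + i ≠ 0) → Rn p s n t = pfEval (range (n + 1)) (fun _ => p - 1 + s) c t)
    {k : ℕ} (hk : k ≤ n) {i : ℕ} (hi1 : 1 ≤ i) (hi2 : i ≤ p - 1 + s) : coeffR p s n i k = c k i := by
  have hk' : k ∈ range (n + 1) := mem_range.2 (by omega)
  have h := divDeriv_eq_coeff_of_pfEval (T := range (n + 1)) (A := p - 1 + s) (f := Rn p s n) (g := RnReg p s n k)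
    (q := fun _ => 0) (c := c) hk' contDiffAt_const (fun t ht => by rw [hc t ht, zero_add])
    (contDiffAt_RnReg_neg p s n k (N := 0)).continuousAt
    (fun t ht => RnReg_eq hp s n k ht (ht k hk')) (a := p - 1 + s - i) (by omega)
  rw [coeffR, h, show p - 1 + s - (p - 1 + s - i) = i by omega]

/-- **(def:r_ik)**: off the poles, `R_n(t) = Σ_{k=0}^{n} Σ_{i=1}^{p−1+s} r_{i,k} (t+k)^{−i}` (under the degree condition;
`p ≥ 1`; the terms `k = 0` carry the coefficients of the removable point `t = 0`).
[cite: LaiLupuSprang2025, Definition 3.2 (def:r_ik)] -/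
theorem Rn_eq_sum_coeffR {p : ℕ} (hp : 1 ≤ p) (s n : ℕ) (hdeg : M0 p s + (p - 1) * n < (p - 1 + s) * (n + 1))
    {t : ℚ} (ht : ∀ j ∈ range (n + 1), t + j ≠ 0) :
    Rn p s n t = ∑ k ∈ range (n + 1), ∑ i ∈ Icc 1 (p - 1 + s), coeffR p s n i k * ((t + k) ^ i)⁻¹ := by
  obtain ⟨c, hc⟩ := exists_Rn_eq_pfEval p s n hdeg
  rw [hc t ht, pfEval]
  refine sum_congr rfl fun k hk => sum_congr rfl fun i hi => ?_
  have hi' := mem_Icc.1 hi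
  rw [coeffR_eq_of_pfEval hp s n hc (by have := mem_range.1 hk; omega) hi'.1 hi'.2]

/-! ## §4. The coefficients `ρ_i`, `ρ_{0,j/p}`, `ρ_0` of the linear forms ((4.3), (4.4), (4.8)) -/

/-- `ρ_i := Σ_{k=1}^{n} r_{i,k}` ((4.3); also `ρ_1`, Lemma 4.1), here summed over `0 ≤ k ≤ n`.
[cite: LaiLupuSprang2025, Lemma 4.1 and Lemma 4.3 (4.3)] -/
def rho (p s n i : ℕ) : ℚ := ∑ k ∈ range (n + 1), coeffR p s n i k

/-- `ρ_{0,j/p} := −Σ_{i=1}^{p−1+s} Σ_{k=1}^{n} Σ_{ν=0}^{k−1} r_{i,k}/(ν + j/p)^i` ((4.4)).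
[cite: LaiLupuSprang2025, Lemma 4.3 (4.4)] -/
def rhoZeroJ (p s n j : ℕ) : ℚ :=
  -∑ i ∈ Icc 1 (p - 1 + s), ∑ k ∈ range (n + 1), ∑ ν ∈ range k, coeffR p s n i k / ((ν : ℚ) + (j : ℚ) / p) ^ i

/-- `ρ_0 := Σ_{j=1}^{p−1} ρ_{0,j/p}` ((4.8)). [cite: LaiLupuSprang2025, Lemma 4.5 (4.8)] -/
def rhoZero (p s n : ℕ) : ℚ := ∑ j ∈ Ico 1 p, rhoZeroJ p s n j

/-- The `d_n`-part of **Lemma 5.5**: `d_n^{p−1+s−i} ρ_i ∈ ℤ`. [cite: LaiLupuSprang2025, Lemma 5.5 (with Lemma 5.3)] -/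
theorem exists_int_lcm_pow_mul_rho {p : ℕ} (hp : p.Prime) (s n i : ℕ) :
    ∃ z : ℤ, (Nat.lcmUpto n : ℚ) ^ (p - 1 + s - i) * rho p s n i = z := by
  have h : ∀ k ∈ range (n + 1), ∃ z : ℤ, (Nat.lcmUpto n : ℚ) ^ (p - 1 + s - i) * coeffR p s n i k = z :=
    fun k hk => exists_int_lcm_pow_mul_coeffR hp s n (by have := mem_range.1 hk; omega) i
  choose! z hz using h
  refine ⟨∑ k ∈ range (n + 1), z k, ?_⟩
  rw [rho, mul_sum]
  push_cast
  exact sum_congr rfl hz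

/-! ## §5. Lemma 4.1: `ρ_1 = 0` («`ρ_1 = lim_{t→∞} tR_n(t) = 0` since `deg R_n ≤ −2`») -/

/-- `0 ≤ R_n(N) ≤ p^{pn} n!^s 2^{(p−1)n} / N²` at an integer `N ≥ max(n,1)` under the degree condition
`M₀ + (p−1)n + 2 ≤ (p−1+s)(n+1)` (in `ℝ`). [cite: LaiLupuSprang2025, Lemma 4.1 (proof: deg R_n ≤ −2)] -/
theorem Rn_natCast_bounds (p s n : ℕ) (hdeg : M0 p s + (p - 1) * n + 2 ≤ (p - 1 + s) * (n + 1)) {N : ℕ}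
    (hN : 1 ≤ N) (hNn : n ≤ N) :
    0 ≤ (Rn p s n N : ℝ) ∧
      (Rn p s n N : ℝ) ≤ (p : ℝ) ^ (p * n) * (n ! : ℝ) ^ s * 2 ^ ((p - 1) * n) / (N : ℝ) ^ 2 := by
  have hN1 : (1 : ℝ) ≤ N := by exact_mod_cast hN
  have hNn' : (n : ℝ) ≤ N := by exact_mod_cast hNn
  set E := M0 p s + (p - 1) * n with hE
  set D := (p - 1 + s) * (n + 1) with hD
  have hcast : (Rn p s n N : ℝ) = (p : ℝ) ^ (p * n) * (n ! : ℝ) ^ s * (N : ℝ) ^ M0 p s *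
      (∏ j ∈ Ico 1 p, ∏ m ∈ range n, ((N : ℝ) + ((j : ℝ) / p + m))) /
        (∏ m ∈ range (n + 1), ((N : ℝ) + m)) ^ (p - 1 + s) := by
    rw [Rn]; push_cast; ring
  -- numerator product ≤ (2N)^{(p-1)n}
  have hnum0 : 0 ≤ ∏ j ∈ Ico 1 p, ∏ m ∈ range n, ((N : ℝ) + ((j : ℝ) / p + m)) :=
    prod_nonneg fun j _ => prod_nonneg fun m _ => by positivity
  have hnum : ∏ j ∈ Ico 1 p, ∏ m ∈ range n, ((N : ℝ) + ((j : ℝ) / p + m)) ≤ (2 * (N : ℝ)) ^ ((p - 1) * n) := by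
    have hj : ∀ j ∈ Ico 1 p, ∏ m ∈ range n, ((N : ℝ) + ((j : ℝ) / p + m)) ≤ (2 * (N : ℝ)) ^ n := by
      intro j hj
      have hjp : (j : ℝ) / p ≤ 1 := by
        have hj' := (mem_Ico.1 hj).2
        have hp0 : (0 : ℝ) < p := by exact_mod_cast (show 0 < p by omega)
        rw [div_le_one hp0]; exact_mod_cast hj'.le
      calc ∏ m ∈ range n, ((N : ℝ) + ((j : ℝ) / p + m)) ≤ ∏ _m ∈ range n, (2 * (N : ℝ)) := by
            refine prod_le_prod (fun m _ => by positivity) fun m hm => ?_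
            have hm' : (m : ℝ) + 1 ≤ n := by exact_mod_cast mem_range.1 hm
            linarith
        _ = (2 * (N : ℝ)) ^ n := by rw [prod_const, card_range]
    calc ∏ j ∈ Ico 1 p, ∏ m ∈ range n, ((N : ℝ) + ((j : ℝ) / p + m)) ≤ ∏ _j ∈ Ico 1 p, (2 * (N : ℝ)) ^ n :=
          prod_le_prod (fun j _ => prod_nonneg fun m _ => by positivity) hj
      _ = (2 * (N : ℝ)) ^ ((p - 1) * n) := by rw [prod_const, Nat.card_Ico, ← pow_mul, Nat.mul_comm n (p - 1)]
  -- denominator ≥ N^{(p-1+s)(n+1)}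
  have hden0 : 0 < ∏ m ∈ range (n + 1), ((N : ℝ) + m) := prod_pos fun m _ => by positivity
  have hden : (N : ℝ) ^ D ≤ (∏ m ∈ range (n + 1), ((N : ℝ) + m)) ^ (p - 1 + s) := by
    rw [hD, mul_comm, pow_mul]
    refine pow_le_pow_left₀ (by positivity) ?_ _
    calc (N : ℝ) ^ (n + 1) = ∏ _m ∈ range (n + 1), (N : ℝ) := by rw [prod_const, card_range]
      _ ≤ ∏ m ∈ range (n + 1), ((N : ℝ) + m) := prod_le_prod (fun _ _ => by positivity) fun m _ => by
          have : (0 : ℝ) ≤ m := Nat.cast_nonneg m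
          linarith
  rw [hcast]
  refine ⟨by positivity, ?_⟩
  rw [div_le_div_iff₀ (by positivity) (by positivity)]
  have hED : E + 2 ≤ D := hdeg
  -- N^{M₀} (2N)^{(p-1)n} N^2 ≤ 2^E N^{E+2} ≤ 2^E N^D
  have h2 : (N : ℝ) ^ M0 p s * (2 * (N : ℝ)) ^ ((p - 1) * n) * (N : ℝ) ^ 2 =
      2 ^ ((p - 1) * n) * (N : ℝ) ^ (E + 2) := by
    rw [mul_pow, hE, pow_add, pow_add]; ring
  have h3 : (N : ℝ) ^ (E + 2) ≤ (N : ℝ) ^ D := pow_le_pow_right₀ hN1 hED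
  calc (p : ℝ) ^ (p * n) * (n ! : ℝ) ^ s * (N : ℝ) ^ M0 p s *
        (∏ j ∈ Ico 1 p, ∏ m ∈ range n, ((N : ℝ) + ((j : ℝ) / p + m))) * (N : ℝ) ^ 2
      ≤ (p : ℝ) ^ (p * n) * (n ! : ℝ) ^ s * (N : ℝ) ^ M0 p s * (2 * (N : ℝ)) ^ ((p - 1) * n) * (N : ℝ) ^ 2 := by
        gcongr
    _ = (p : ℝ) ^ (p * n) * (n ! : ℝ) ^ s * 2 ^ ((p - 1) * n) * (N : ℝ) ^ (E + 2) := by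
        rw [show (p : ℝ) ^ (p * n) * (n ! : ℝ) ^ s * (N : ℝ) ^ M0 p s * (2 * (N : ℝ)) ^ ((p - 1) * n) * (N : ℝ) ^ 2
          = (p : ℝ) ^ (p * n) * (n ! : ℝ) ^ s * ((N : ℝ) ^ M0 p s * (2 * (N : ℝ)) ^ ((p - 1) * n) * (N : ℝ) ^ 2) by ring,
          h2]; ring
    _ ≤ (p : ℝ) ^ (p * n) * (n ! : ℝ) ^ s * 2 ^ ((p - 1) * n) * (N : ℝ) ^ D := by gcongr
    _ ≤ (p : ℝ) ^ (p * n) * (n ! : ℝ) ^ s * 2 ^ ((p - 1) * n) * (∏ m ∈ range (n + 1), ((N : ℝ) + m)) ^ (p - 1 + s) := by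
        gcongr

/-- `N·R_n(N) → 0` as `N → ∞` («`lim_{t→∞} tR_n(t) = 0`»). [cite: LaiLupuSprang2025, Lemma 4.1 (proof)] -/
private theorem tendsto_natCast_mul_Rn (p s n : ℕ) (hdeg : M0 p s + (p - 1) * n + 2 ≤ (p - 1 + s) * (n + 1)) :
    Tendsto (fun N : ℕ => (N : ℝ) * (Rn p s n N : ℝ)) atTop (𝓝 0) := by
  set Cst : ℝ := (p : ℝ) ^ (p * n) * (n ! : ℝ) ^ s * 2 ^ ((p - 1) * n) with hC
  have hup : Tendsto (fun N : ℕ => Cst / (N : ℝ)) atTop (𝓝 0) := tendsto_const_div_atTop_nhds_zero_nat _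
  refine squeeze_zero' ?_ ?_ hup
  · filter_upwards [eventually_ge_atTop (max n 1)] with N hN
    exact mul_nonneg (Nat.cast_nonneg N) (Rn_natCast_bounds p s n hdeg (le_of_max_le_right hN) (le_of_max_le_left hN)).1
  · filter_upwards [eventually_ge_atTop (max n 1)] with N hN
    have hN1 : 1 ≤ N := le_of_max_le_right hN
    have hN0 : (0 : ℝ) < N := by exact_mod_cast hN1
    have h := (Rn_natCast_bounds p s n hdeg hN1 (le_of_max_le_left hN)).2
    calc (N : ℝ) * (Rn p s n N : ℝ) ≤ N * (Cst / (N : ℝ) ^ 2) := mul_le_mul_of_nonneg_left h hN0.le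
      _ = Cst / (N : ℝ) := by field_simp

/-- **Lemma 4.1: `ρ_1 = 0`**, i.e. `Σ_k r_{1,k} = 0` (`p ≥ 1`, degree condition `M₀ + (p−1)n + 2 ≤ (p−1+s)(n+1)`):
`Σ_k r_{1,k} = lim_{N→∞} N·R_n(N) = 0`, while `N·(N+k)^{−i} → 0` for `i ≥ 2`.
[cite: LaiLupuSprang2025, Lemma 4.1] -/
theorem rho_one_eq_zero {p : ℕ} (hp : 1 ≤ p) (s n : ℕ) (hdeg : M0 p s + (p - 1) * n + 2 ≤ (p - 1 + s) * (n + 1)) :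
    rho p s n 1 = 0 := by
  have hdeg' : M0 p s + (p - 1) * n < (p - 1 + s) * (n + 1) :=
    lt_of_lt_of_le (Nat.lt_add_of_pos_right (by norm_num : 0 < 2)) hdeg
  set L : ℕ → ℕ → ℝ := fun i k => if i = 1 then (coeffR p s n 1 k : ℝ) else 0 with hL
  have hterm : ∀ k ∈ range (n + 1), ∀ i ∈ (Icc 1 (p - 1 + s) : Finset ℕ),
      Tendsto (fun N : ℕ => (N : ℝ) * ((coeffR p s n i k : ℝ) * (((N : ℝ) + k) ^ i)⁻¹)) atTop (𝓝 (L i k)) := by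
    intro k _ i hi
    have h1 : Tendsto (fun N : ℕ => (N : ℝ) / ((N : ℝ) + k)) atTop (𝓝 1) := tendsto_natCast_div_add_atTop (k : ℝ)
    by_cases hi' : i = 1
    · subst hi'
      simp only [hL, if_true, pow_one]
      have := h1.const_mul (coeffR p s n 1 k : ℝ)
      rw [mul_one] at this
      refine this.congr fun N => ?_
      ring
    · simp only [hL, if_neg hi']
      obtain ⟨r, rfl⟩ : ∃ r, i = r + 1 := ⟨i - 1, by have := mem_Icc.1 hi; omega⟩
      have hr : 1 ≤ r := by have := mem_Icc.1 hi; omega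
      have h2 : Tendsto (fun N : ℕ => (((N : ℝ) + k) ^ r)⁻¹) atTop (𝓝 0) := by
        have ht : Tendsto (fun N : ℕ => ((N : ℝ) + k) ^ r) atTop atTop := by
          refine (tendsto_pow_atTop (by omega)).comp ?_
          exact tendsto_atTop_add_const_right _ _ tendsto_natCast_atTop_atTop
        exact ht.inv_tendsto_atTop
      have h := (h1.mul h2).const_mul (coeffR p s n (r + 1) k : ℝ)
      rw [one_mul, mul_zero] at h
      refine h.congr' ?_
      filter_upwards [eventually_ge_atTop 1] with N hN
      have hNk : ((N : ℝ) + k) ≠ 0 := by positivity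
      rw [pow_succ]
      field_simp
  have hsum : Tendsto (fun N : ℕ => (N : ℝ) * ∑ k ∈ range (n + 1), ∑ i ∈ (Icc 1 (p - 1 + s) : Finset ℕ),
      (coeffR p s n i k : ℝ) * (((N : ℝ) + k) ^ i)⁻¹) atTop
      (𝓝 (∑ k ∈ range (n + 1), ∑ i ∈ (Icc 1 (p - 1 + s) : Finset ℕ), L i k)) := by
    have h := tendsto_finsetSum (range (n + 1)) fun k hk =>
      tendsto_finsetSum (Icc 1 (p - 1 + s) : Finset ℕ) fun i hi => hterm k hk i hi
    refine h.congr fun N => ?_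
    rw [mul_sum]
    exact sum_congr rfl fun k _ => by rw [mul_sum]
  have hA1 : 1 ≤ p - 1 + s := by
    rcases Nat.eq_zero_or_pos (p - 1 + s) with h | h
    · rw [h, zero_mul] at hdeg; omega
    · exact h
  have hLsum : ∑ k ∈ range (n + 1), ∑ i ∈ (Icc 1 (p - 1 + s) : Finset ℕ), L i k = ((rho p s n 1 : ℚ) : ℝ) := by
    rw [rho]
    push_cast
    refine sum_congr rfl fun k _ => ?_
    rw [sum_ite_eq' (Icc 1 (p - 1 + s) : Finset ℕ) 1 (fun _ => (coeffR p s n 1 k : ℝ)), if_pos (mem_Icc.2 ⟨le_rfl, hA1⟩)]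
  have heq : ∀ᶠ N : ℕ in atTop, (N : ℝ) * (Rn p s n N : ℝ) =
      (N : ℝ) * ∑ k ∈ range (n + 1), ∑ i ∈ (Icc 1 (p - 1 + s) : Finset ℕ),
        (coeffR p s n i k : ℝ) * (((N : ℝ) + k) ^ i)⁻¹ := by
    filter_upwards [eventually_ge_atTop 1] with N hN
    have hne : ∀ j ∈ range (n + 1), (N : ℚ) + j ≠ 0 := fun j _ => by positivity
    rw [Rn_eq_sum_coeffR hp s n hdeg' hne]
    push_cast
    rfl
  have hlim := (tendsto_natCast_mul_Rn p s n hdeg).congr' heq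
  have huniq := tendsto_nhds_unique hlim hsum
  rw [hLsum] at huniq
  exact_mod_cast huniq.symm

end Literature.NumberTheory.Irrationality.LaiLupuSprang2025
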